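import Summits.CriticalPhenomena.PercolationContinuityZ3.Theorems.PercAnnulusCrossingSlabSubcritical
import Literature.Probability.Percolation.SlabBoxCrossingProperty
import Literature.Probability.Percolation.SlabRSWHalfSide
import Literature.Probability.Percolation.SlabGluingRouting
import Literature.Probability.Percolation.CriticalContinuityProofs
import Literature.Probability.Percolation.RSW
import HarnessLib

/-!
# RSW3 lane (lead GEN 39): THE SMALL-PARAMETER BOUND (HL) OF NEWMAN–TASSION–WU'S THEOREM 3.10 —
# `f_p(2n, n-1) ≤ 1/2` for every `p ≤ p_c(ℤ³)` and every large `n`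

builds on p205010 (kernel theorem, internal audit signed; external expert review pending) — NOT used in this file.

Cell `prim-rsw3` (LANE 3), lead seat, gen 39.  Support file (`--supports stmt-CriticalPhenomena-4575`); no definitions, no named
facts, no sorries.  NTW (arXiv p. 12, before Theorem 3.10): "by elementary arguments (e.g., by bounding the expected number of open
self-avoiding paths of length `m` starting from a given vertex), it is easy to see that there is some `ε > 0` (depending only on `k`)
such that `sup_{n ≥ 2} f_ε(2n, n-1) < 1/2`."  This is the hypothesis (HL) of p1's `NTW17.h310_of_cornerGlue`
(`Literature/…/SlabCircuitTheorem310.lean`).  We prove it with `ε₀ = p_c(ℤ³)`, where the slab `S_k` is exponentially subcritical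
(`Plates.exists_exp_decay_armEvent_slab_criticalProbI`, Martineau–Severo + sharpness): a left-right crossing of
`[0,m] × [0,n']` starts at one of the `(n'+1)(k+1)` vertices over the left side and reaches graph distance `≥ m`, so
`f_p(m,n') ≤ (n'+1)(k+1) e^{-cm}`; monotonicity in `p` (`DCT16.real_mono_of_isUpperSet`) handles `p ≤ p_c(ℤ³)`.

* `armEvent_of_slabConn_lr` — a crossing gives an arm of length `m` at a left-side vertex (lattice configurations).
* `crossingProb_le_sum_armEvent`, `crossingProb_le_card_mul_exp` — the union bound and the exponential bound at `p_c(ℤ³)`.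
* `crossingProb_mono_param` — `f_p(m,n)` is non-decreasing in `p`.
* **`h310_smallParam`** — (HL): `∃ ε₀ > 0, ∃ n₀, ∀ n ≥ n₀, ∀ p ≤ ε₀, f_p(2n, n-1) ≤ 1/2`.

References: C. M. Newman, V. Tassion, W. Wu, *Critical percolation and the minimal spanning tree in slabs*, CPAM 70 (2017) =
arXiv:1512.09107, §3.4 (remark before Theorem 3.10) [NewmanTassionWu2017]; S. Martineau, F. Severo, *Ann. Probab.* 47 (2019),
Cor. 2.2 [MartineauSevero2019]; H. Duminil-Copin, V. Tassion, *Comm. Math. Phys.* 343 (2016), Thm 1.1 [DuminilCopinTassionCMP2016].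
-/

noncomputable section

namespace Summit.CriticalPhenomena.PercolationContinuityZ3.Theorems.Crossing

open MeasureTheory Finset
open Literature.Probability.Percolation Literature.Probability.LatticeModels
open Literature.Probability.Percolation.DCTQ Literature.Probability.Percolation.NTW17

variable {k : ℕ}

/-- **A crossing gives an arm.** If a lattice configuration has an open path inside the lift of `[0,m] × [0,n']` from the lift
of `{x = 0}` to the lift of `{x = m}`, then some vertex `v` over `{0} × [0,n']` is joined inside the ball `B(v, m)` of the slab
graph to its inner boundary (the endpoint is at `ℓ¹`-, hence graph-, distance `≥ m`).
[cite: NewmanTassionWu2017, §3.4 (remark before Theorem 3.10: open self-avoiding paths of length m from a given vertex)] -/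
theorem armEvent_of_slabConn_lr {ω : BondConfig (slab 3 k)} (hω : ω ⊆ (slabGraph 3 k).edgeSet) {m n' : ℕ}
    (h : ω ∈ slabConn k (boxR 0 m 0 n') {z | z.1 = 0} {z | z.1 = (m : ℤ)}) :
    ∃ jh ∈ Finset.range (n' + 1) ×ˢ Finset.range (k + 1),
      ω ∈ armEvent (slabGraph 3 k) (vtx k ((0 : ℤ), (jh.1 : ℤ)) jh.2) m := by
  classical
  obtain ⟨x, hx, y, hy, hxy⟩ := h
  rw [mem_slabLift_iff] at hx hy
  simp only [Set.mem_setOf_eq] at hx hy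
  have hxy' := hxy
  obtain ⟨hxS, -, -⟩ := hxy'
  rw [mem_slabLift_iff, mem_boxR_iff] at hxS
  have hpath := DCT16.pathIn_of_mem_openConnIn hxy
  -- the endpoint is far in the first planar coordinate
  have hfar : (m : ℤ) ≤ |(y : Site 3) 1 - (x : Site 3) 1| := by
    have h1 : (y : Site 3) 1 = (m : ℤ) := hy
    have h2 : (x : Site 3) 1 = 0 := hx
    rw [h1, h2, sub_zero, abs_of_nonneg (by positivity)]
  have harm : ω ∈ armEvent (slabGraph 3 k) x m :=
    armEvent_of_pathIn hω hpath (Plates.notMem_or_mem_innerBoundary_ball_slab (d := 3) (by norm_num) 1 hfar)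
  -- name the vertex by its planar second coordinate and its height
  refine ⟨(((planar k x).2).toNat, ht x), ?_, ?_⟩
  · rw [Finset.mem_product, Finset.mem_range, Finset.mem_range]
    refine ⟨?_, Nat.lt_succ_of_le (ht_le x)⟩
    have : ((planar k x).2).toNat ≤ n' := by
      have h0 : 0 ≤ (planar k x).2 := hxS.2.2.1
      have h1 : (planar k x).2 ≤ n' := hxS.2.2.2
      omega
    omega
  · have hxeq : vtx k ((0 : ℤ), ((((planar k x).2).toNat : ℕ) : ℤ)) (ht x) = x := by
      have h0 : 0 ≤ (planar k x).2 := hxS.2.2.1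
      have : ((0 : ℤ), ((((planar k x).2).toNat : ℕ) : ℤ)) = planar k x := by
        ext
        · exact hx.symm
        · simp only [Int.toNat_of_nonneg h0]
      rw [this, vtx_planar_ht]
    simpa only [hxeq] using harm

/-- **The union bound**: `f_p(m, n') ≤ Σ_{v over {0}×[0,n']} P_p[v ⟷ ∂B(v,m) in B(v,m)]`.
[cite: NewmanTassionWu2017, §3.4 (remark before Theorem 3.10)] -/
theorem crossingProb_le_sum_armEvent (p : unitInterval) (m n' : ℕ) :
    NTW17.crossingProb k p m n' ≤ ∑ jh ∈ Finset.range (n' + 1) ×ˢ Finset.range (k + 1),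
      (bondPercolation (slabGraph 3 k) p).real (armEvent (slabGraph 3 k) (vtx k ((0 : ℤ), (jh.1 : ℤ)) jh.2) m) := by
  classical
  set P := bondPercolation (slabGraph 3 k) p with hP
  unfold NTW17.crossingProb
  have hae : ∀ᵐ ω ∂P, ω ∈ slabConn k (boxR 0 m 0 n') {z | z.1 = 0} {z | z.1 = (m : ℤ)} →
      ω ∈ ⋃ jh ∈ Finset.range (n' + 1) ×ˢ Finset.range (k + 1),
        armEvent (slabGraph 3 k) (vtx k ((0 : ℤ), (jh.1 : ℤ)) jh.2) m := by
    filter_upwards [ae_subset_edgeSet (slabGraph 3 k) p] with ω hω h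
    obtain ⟨jh, hjh, hmem⟩ := armEvent_of_slabConn_lr hω h
    exact Set.mem_biUnion hjh hmem
  calc P.real (slabConn k (boxR 0 m 0 n') {z | z.1 = 0} {z | z.1 = (m : ℤ)})
      ≤ P.real (⋃ jh ∈ Finset.range (n' + 1) ×ˢ Finset.range (k + 1),
          armEvent (slabGraph 3 k) (vtx k ((0 : ℤ), (jh.1 : ℤ)) jh.2) m) := by
        simp only [measureReal_def]
        exact ENNReal.toReal_mono (measure_ne_top _ _) (measure_mono_ae hae)
    _ ≤ _ := measureReal_biUnion_finset_le _ _

/-- **Exponential bound at `p_c(ℤ³)`**: with the decay constant `c` of `exists_exp_decay_armEvent_slab_criticalProbI`,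
`f_{p_c(ℤ³)}(m, n') ≤ (n'+1)(k+1) e^{-cm}`. [cite: NewmanTassionWu2017, §3.4 (remark before Theorem 3.10)] [cite: MartineauSevero2019, Cor. 2.2] -/
theorem crossingProb_le_card_mul_exp {c : ℝ}
    (hc : ∀ (v : slab 3 k) (n : ℕ), (bondPercolation (slabGraph 3 k) (criticalProbI 3)).real (armEvent (slabGraph 3 k) v n) ≤
      Real.exp (-(c * n))) (m n' : ℕ) :
    NTW17.crossingProb k (criticalProbI 3) m n' ≤ ((n' + 1) * (k + 1) : ℕ) * Real.exp (-(c * m)) := by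
  classical
  refine (crossingProb_le_sum_armEvent (criticalProbI 3) m n').trans ?_
  have hsum := Finset.sum_le_card_nsmul (Finset.range (n' + 1) ×ˢ Finset.range (k + 1))
    (fun jh => (bondPercolation (slabGraph 3 k) (criticalProbI 3)).real
      (armEvent (slabGraph 3 k) (vtx k ((0 : ℤ), (jh.1 : ℤ)) jh.2) m)) (Real.exp (-(c * m)))
    (fun jh _ => hc _ m)
  refine hsum.trans (le_of_eq ?_)
  rw [Finset.card_product, Finset.card_range, Finset.card_range, nsmul_eq_mul]

/-- `f_p(m, n)` is non-decreasing in `p` (the crossing event is increasing and measurable).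
[cite: NewmanTassionWu2017, §3.4 (proof of Theorem 3.10: "one can lower the value of p … monotonicity")] -/
theorem crossingProb_mono_param {p q : unitInterval} (hpq : p ≤ q) (m n : ℕ) :
    NTW17.crossingProb k p m n ≤ NTW17.crossingProb k q m n :=
  DCT16.real_mono_of_isUpperSet (slabGraph 3 k) (isUpperSet_openCrossing _ _ _) (measurableSet_slabConn_boxR _ _ _ _ _ _) hpq

/-- An elementary threshold: for `c > 0`, `n ≥ 1` and `K ≤ c² n`, `n · K · e^{-c·2n} ≤ 1/2` (from `e^{x} ≥ x²/2`). [folklore] -/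
theorem mul_exp_neg_le_half {c K : ℝ} (hc : 0 < c) {n : ℕ} (hn : 1 ≤ n) (hKn : K ≤ c ^ 2 * n) :
    (n : ℝ) * K * Real.exp (-(c * ((2 * n : ℕ) : ℝ))) ≤ 1 / 2 := by
  have hn0 : (0 : ℝ) < n := by exact_mod_cast hn
  have hx : 0 ≤ c * ((2 * n : ℕ) : ℝ) := by positivity
  -- `e^{2cn} ≥ (2cn)²/2 = 2 c² n²`
  have hexp : 2 * c ^ 2 * (n : ℝ) ^ 2 ≤ Real.exp (c * ((2 * n : ℕ) : ℝ)) := by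
    have h := Real.pow_div_factorial_le_exp _ hx 2
    have h2 : ((2 : ℕ).factorial : ℝ) = 2 := by norm_num [Nat.factorial]
    rw [h2] at h
    have : (c * ((2 * n : ℕ) : ℝ)) ^ 2 / 2 = 2 * c ^ 2 * (n : ℝ) ^ 2 := by push_cast; ring
    linarith
  have hpos : 0 < Real.exp (c * ((2 * n : ℕ) : ℝ)) := Real.exp_pos _
  rw [Real.exp_neg]
  rw [show (n : ℝ) * K * (Real.exp (c * ((2 * n : ℕ) : ℝ)))⁻¹ = (n : ℝ) * K / Real.exp (c * ((2 * n : ℕ) : ℝ)) from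
    by rw [div_eq_mul_inv]]
  rw [div_le_iff₀ hpos]
  have h1 : (n : ℝ) * K ≤ (n : ℝ) * (c ^ 2 * n) := mul_le_mul_of_nonneg_left hKn hn0.le
  nlinarith

/-- **(HL) — the small-parameter bound of NTW's Theorem 3.10**: there are `ε₀ > 0` (namely `p_c(ℤ³)`) and `n₀` such that
`f_p(2n, n-1) ≤ 1/2` for every `n ≥ n₀` and every `p ≤ ε₀`; this is the hypothesis `HL` of `NTW17.h310_of_cornerGlue`, for
every `k`. [cite: NewmanTassionWu2017, §3.4 (remark before Theorem 3.10; (3.34))] [cite: MartineauSevero2019, Cor. 2.2] -/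
theorem h310_smallParam (k : ℕ) :
    ∃ ε₀ : ℝ, 0 < ε₀ ∧ ∃ n₀ : ℕ, ∀ n : ℕ, n₀ ≤ n → ∀ p : unitInterval, (p : ℝ) ≤ ε₀ →
      NTW17.crossingProb k p (2 * n) (n - 1) ≤ 1 / 2 := by
  obtain ⟨c, hc, hdec⟩ := Plates.exists_exp_decay_armEvent_slab_criticalProbI (d := 3) (by norm_num) k
  refine ⟨(criticalProbI 3 : ℝ), ?_, Nat.ceil (((k : ℝ) + 1) / c ^ 2) + 1, fun n hn p hp => ?_⟩
  · rw [coe_criticalProbI]; exact criticalProb_zd_pos 3 (by norm_num)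
  have hn1 : 1 ≤ n := le_trans (Nat.le_add_left 1 _) hn
  have hpq : p ≤ criticalProbI 3 := Subtype.coe_le_coe.1 hp
  refine (crossingProb_mono_param hpq _ _).trans ?_
  refine (crossingProb_le_card_mul_exp hdec (2 * n) (n - 1)).trans ?_
  have hcard : (((n - 1 + 1) * (k + 1) : ℕ) : ℝ) = (n : ℝ) * ((k : ℝ) + 1) := by
    rw [Nat.sub_add_cancel hn1]; push_cast; ring
  rw [hcard]
  refine mul_exp_neg_le_half hc hn1 ?_
  -- `k + 1 ≤ c² n` from `n ≥ ⌈(k+1)/c²⌉ + 1`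
  have hceil : ((k : ℝ) + 1) / c ^ 2 ≤ (Nat.ceil (((k : ℝ) + 1) / c ^ 2) : ℝ) := Nat.le_ceil _
  have hn' : (Nat.ceil (((k : ℝ) + 1) / c ^ 2) : ℝ) + 1 ≤ n := by exact_mod_cast hn
  have hc2 : 0 < c ^ 2 := by positivity
  rw [div_le_iff₀ hc2] at hceil
  nlinarith

end Summit.CriticalPhenomena.PercolationContinuityZ3.Theorems.Crossing

end
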